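import Literature.MathematicalPhysics.KineticTheory.CollisionTubePullbackPathwise
import Literature.MathematicalPhysics.KineticTheory.CollisionTubePullbackPacking
import Summits.AtomisticToContinuum.HydrodynamicLimit.Theorems.JParityClosureEvenStressEnskogTubeStatRegular
import Summits.AtomisticToContinuum.HydrodynamicLimit.Theorems.ImplosionDichotomyHsEosLowDensity
import HarnessLib

/-!
# `stub_cylinderPullbackOfStar`: the registered cylinder pull-back (S2) from its tube form (S2\*)
# (helper stub, S2 glue of the crux line `even-rung-mean-variance`, `JParityClosure.EvenStressEnskog`,
# stmt-AtomisticToContinuum-13079)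

The registered stub S2 compares `evenStat` (collision sum minus `σ³ ∫₀^τ e_s(Φ_s z) ds`) with
`evenTubeTimeStat` (`∫₀^τ (A_t − σ³ e_t)(Φ_t z) dt`); its tube form S2\* compares `collisionSum` with
`tubeTimeStat … 1 κ` directly.  The two differences AGREE on every good orbit along which both one-time
functionals `A_t = tubeStat … 1 κ t` and `e_t = enskogRate … t` are integrable in time
(`evenStat_sub_evenTubeTimeStat_eq`), which holds for ALL good orbits once `(t, z) ↦ A_t(z)` and
`(t, z) ↦ W_t(z) = A_t(z) − σ³ e_t(z)` are jointly measurable and uniformly bounded on `[0, τ] × Config`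
(`integrableOn_orbit_of_measurable_bounded`; `e = σ⁻³ (A − W)`): the tube part is
`Theorems.measurable_tubeStat_uncurry` / `Theorems.exists_bound_tubeStat` (13078's S6), the even part is
this line's S6 `stub_evenTubeStatRegular` fed with the PROVED equation of state
`Theorems.hsEosLowDensity_proof`.  Bad orbits are `localGibbsLaw`-null (`localGibbsLaw_goodCompl`), so
the two events have the same probability and S2\* ⇒ S2 (with `η₀ := min` of the two thresholds).
-/

noncomputable section

open scoped BigOperators Classical InnerProductSpace ENNReal Topology
open Set MeasureTheory Filter Function

namespace Summit.AtomisticToContinuum.HydrodynamicLimit.Theorems.EvenStressEnskog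

open Literature.Analysis.FluidPDE Literature.MathematicalPhysics.KineticTheory

/-- The equation of state of the route `JParityClosure` (identical body to the proved
`ImplosionDichotomy.HsEosLowDensity`). [folklore] -/
theorem hsEosLowDensity_jParity :
    Summit.AtomisticToContinuum.HydrodynamicLimit.Theses.JParityClosure.HsEosLowDensity :=
  Summit.AtomisticToContinuum.HydrodynamicLimit.Theorems.hsEosLowDensity_proof

/-- **Integrability of the tube functional and of the Enskog rate along good orbits.**  For `σ > 0`,
continuous `χ, g` with `g = 0` on `[η₆, ∞)` (`η₆` the threshold of S6), `L ≥ 0`, `r > 0`, `κ ≥ 0`: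
along the orbit of every good `z`, `t ↦ A_t(Φ_t z)` and `t ↦ e_t(Φ_t z)` are integrable on `[0, τ]`.
[folklore] -/
theorem integrableOn_tubeStat_enskogRate_orbit {η₆ : ℝ}
    (H6 : ∀ (σ : ℝ) (N : ℕ) (χ : ℝ × UnitAddTorus (Fin 3) → ℝ) (g : ℝ → ℝ) (k l : Fin 3) (L r κ τ : ℝ),
      0 < σ → Continuous χ → Continuous g → (∀ a, η₆ ≤ a → g a = 0) → 0 ≤ L → 0 < r → 0 ≤ κ →
      Measurable (fun p : ℝ × Config (N + 1) (Fin 3) T3 => evenTubeStat σ N χ g (evenMarkTrunc k l L) r κ p.1 p.2) ∧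
      ∃ B : ℝ, ∀ t ∈ Set.Icc (0 : ℝ) τ, ∀ z : Config (N + 1) (Fin 3) T3,
        |evenTubeStat σ N χ g (evenMarkTrunc k l L) r κ t z| ≤ B)
    {σ : ℝ} {N : ℕ} {Φ : HardSphereFlow (Torus.geometry (Fin 3)) (hsDiameter σ N) (N + 1)}
    {z : Config (N + 1) (Fin 3) T3} (hz : z ∈ Φ.good) {χ : ℝ × UnitAddTorus (Fin 3) → ℝ} {g : ℝ → ℝ}
    (k l : Fin 3) {L r κ τ : ℝ} (hσ : 0 < σ) (hχ : Continuous χ) (hg : Continuous g)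
    (hg6 : ∀ a, η₆ ≤ a → g a = 0) (hL : 0 ≤ L) (hr : 0 < r) (hκ : 0 ≤ κ) :
    IntegrableOn (fun t => tubeStat σ N χ g (evenMarkTrunc k l L) r r 1 κ t (Φ.flow t z)) (Icc 0 τ) ∧
      IntegrableOn (fun t => enskogRate σ N χ g (evenMarkTrunc k l L) r t (Φ.flow t z)) (Icc 0 τ) := by
  have hΨc := continuous_evenMarkTrunc k l L
  have hA := Theorems.measurable_tubeStat_uncurry σ N hχ hg hΨc r r 1 κ
  obtain ⟨BA, hBA⟩ := Theorems.exists_bound_tubeStat σ N hχ hg (exists_abs_evenMarkTrunc_le k l hL) hr r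
    zero_le_one hκ τ
  obtain ⟨hW, BW, hBW⟩ := H6 σ N χ g k l L r κ τ hσ hχ hg hg6 hL hr hκ
  have hσ3 : 0 < σ ^ 3 := by positivity
  -- `e = σ⁻³ (A − W)`
  have he_eq : ∀ (t : ℝ) (ζ : Config (N + 1) (Fin 3) T3), enskogRate σ N χ g (evenMarkTrunc k l L) r t ζ =
      (σ ^ 3)⁻¹ * (tubeStat σ N χ g (evenMarkTrunc k l L) r r 1 κ t ζ -
        evenTubeStat σ N χ g (evenMarkTrunc k l L) r κ t ζ) := by
    intro t ζ
    rw [evenTubeStat_def, sub_sub_cancel, ← mul_assoc, inv_mul_cancel₀ hσ3.ne', one_mul]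
  have hE : Measurable (fun p : ℝ × Config (N + 1) (Fin 3) T3 => enskogRate σ N χ g (evenMarkTrunc k l L) r p.1 p.2) := by
    have : (fun p : ℝ × Config (N + 1) (Fin 3) T3 => enskogRate σ N χ g (evenMarkTrunc k l L) r p.1 p.2) =
        fun p => (σ ^ 3)⁻¹ * (tubeStat σ N χ g (evenMarkTrunc k l L) r r 1 κ p.1 p.2 -
          evenTubeStat σ N χ g (evenMarkTrunc k l L) r κ p.1 p.2) := funext fun p => he_eq p.1 p.2
    rw [this]
    exact (hA.sub hW).const_mul _
  have hBE : ∀ t ∈ Set.Icc (0 : ℝ) τ, ∀ ζ : Config (N + 1) (Fin 3) T3,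
      |enskogRate σ N χ g (evenMarkTrunc k l L) r t ζ| ≤ (σ ^ 3)⁻¹ * (BA + BW) := by
    intro t ht ζ
    rw [he_eq, abs_mul, abs_of_pos (inv_pos.2 hσ3)]
    refine mul_le_mul_of_nonneg_left ((abs_sub _ _).trans (add_le_add (hBA t ht ζ) (hBW t ht ζ))) ?_
    positivity
  exact ⟨integrableOn_orbit_of_measurable_bounded hz hA hBA, integrableOn_orbit_of_measurable_bounded hz hE hBE⟩

/-- **S2 from S2\*** (registered helper stub `stub_cylinderPullbackOfStar`): the registered cylinder
pull-back `P(|evenStat … (evenMarkTrunc k l L) r z − evenTubeTimeStat … r κ z| > η) ≤ δ` follows from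
its tube form `P(|collisionSum … r z − tubeTimeStat … r r 1 κ z| > η) ≤ δ` in the same frame, the two
statistics being equal on every good orbit by the exact Enskog slicing (integrability from S6 and the
proved equation of state) and the bad set being null. [folklore] -/
theorem stub_cylinderPullbackOfStar :
    (∃ η₀ : ℝ, 0 < η₀ ∧ ∀ (a₀ θ₀ : T3 → ℝ) (u₀ : T3 → V3), Continuous a₀ → Continuous θ₀ → Continuous u₀ → (∀ x, 0 < a₀ x) → (∀ x, 0 < θ₀ x) → ∃ σ₀ : ℝ, 0 < σ₀ ∧ ∀ σ : ℝ, 0 < σ → σ < σ₀ → ∀ Φ : (N : ℕ) → HardSphereFlow (Torus.geometry (Fin 3)) (hsDiameter σ N) (N + 1), ∀ τ : ℝ, 0 < τ → ∀ χ : ℝ × UnitAddTorus (Fin 3) → ℝ, Continuous χ → ∀ g : ℝ → ℝ, Continuous g → (∀ a, η₀ ≤ a → g a = 0) → ∀ η δ : ℝ, 0 < η → 0 < δ → ∃ r₀ : ℝ, 0 < r₀ ∧ ∀ r : ℝ, 0 < r → r < r₀ → ∀ L : ℝ, 1 ≤ L → ∃ κ₀ : ℝ, 0 < κ₀ ∧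 ∀ κ : ℝ, 0 < κ → κ < κ₀ → ∃ N₀ : ℕ, ∀ N : ℕ, N₀ ≤ N → ∀ k l : Fin 3, localGibbsLaw σ a₀ u₀ θ₀ N (Φ N) {z | η < |collisionSum σ N (Φ N) τ χ g (evenMarkTrunc k l L) r z - tubeTimeStat σ N (Φ N) τ χ g (evenMarkTrunc k l L) r r 1 κ z|} ≤ ENNReal.ofReal δ) → ∃ η₀ : ℝ, 0 < η₀ ∧ ∀ (a₀ θ₀ : T3 → ℝ) (u₀ : T3 → V3), Continuous a₀ → Continuous θ₀ → Continuous u₀ → (∀ x, 0 < a₀ x) → (∀ x, 0 < θ₀ x) → ∃ σ₀ : ℝ, 0 < σ₀ ∧ ∀ σ : ℝ, 0 < σ → σ < σ₀ → ∀ Φ : (N : ℕ) → HardSphereFlow (Torus.geometry (Fin 3)) (hsDiameter σ N) (N + 1), ∀ τ : ℝ, 0 < τ → ∀ χ : ℝ × UnitAddTorus (Fin 3) → ℝ, Continuous χ → ∀ g : ℝ → ℝ, Continuous g → (∀ a, η₀ ≤ a → g a = 0) → ∀ η δ : ℝ, 0 < η → 0 < δ → ∃ r₀ : ℝ, 0 <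 r₀ ∧ ∀ r : ℝ, 0 < r → r < r₀ → ∀ L : ℝ, 1 ≤ L → ∃ κ₀ : ℝ, 0 < κ₀ ∧ ∀ κ : ℝ, 0 < κ → κ < κ₀ → ∃ N₀ : ℕ, ∀ N : ℕ, N₀ ≤ N → ∀ k l : Fin 3, localGibbsLaw σ a₀ u₀ θ₀ N (Φ N) {z | η < |evenStat σ N (Φ N) τ χ g (evenMarkTrunc k l L) r z - evenTubeTimeStat σ N (Φ N) τ χ g (evenMarkTrunc k l L) r κ z|} ≤ ENNReal.ofReal δ := by
  intro hStar
  obtain ⟨η₆, hη₆, H6⟩ := stub_evenTubeStatRegular hsEosLowDensity_jParity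
  obtain ⟨η₁, hη₁, H1⟩ := hStar
  refine ⟨min η₁ η₆, lt_min hη₁ hη₆, ?_⟩
  intro a₀ θ₀ u₀ ha hθ hu ha0 hθ0
  obtain ⟨σ₁, hσ₁, H1⟩ := H1 a₀ θ₀ u₀ ha hθ hu ha0 hθ0
  refine ⟨σ₁, hσ₁, ?_⟩
  intro σ hσ hσ1 Φ τ hτ χ hχ g hg hg0 η δ hη hδ
  have hg1 : ∀ a, η₁ ≤ a → g a = 0 := fun a h => hg0 a ((min_le_left _ _).trans h)
  have hg6 : ∀ a, η₆ ≤ a → g a = 0 := fun a h => hg0 a ((min_le_right _ _).trans h)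
  obtain ⟨r₁, hr₁, H1⟩ := H1 σ hσ hσ1 Φ τ hτ χ hχ g hg hg1 η δ hη hδ
  refine ⟨r₁, hr₁, ?_⟩
  intro r hr hrlt L hL
  have hL0 : 0 ≤ L := zero_le_one.trans hL
  obtain ⟨κ₁, hκ₁, H1⟩ := H1 r hr hrlt L hL
  refine ⟨κ₁, hκ₁, ?_⟩
  intro κ hκ hκlt
  obtain ⟨N₁, H1⟩ := H1 κ hκ hκlt
  refine ⟨N₁, fun N hN k l => ?_⟩
  have E1 := H1 N hN k l
  set P := localGibbsLaw σ a₀ u₀ θ₀ N (Φ N) with hP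
  set E := {z : Config (N + 1) (Fin 3) T3 | η < |evenStat σ N (Φ N) τ χ g (evenMarkTrunc k l L) r z -
    evenTubeTimeStat σ N (Φ N) τ χ g (evenMarkTrunc k l L) r κ z|} with hE
  set E' := {z : Config (N + 1) (Fin 3) T3 | η < |collisionSum σ N (Φ N) τ χ g (evenMarkTrunc k l L) r z -
    tubeTimeStat σ N (Φ N) τ χ g (evenMarkTrunc k l L) r r 1 κ z|} with hE'
  have hsub : E ∩ (Φ N).good ⊆ E' := by
    rintro z ⟨hz, hgood⟩
    obtain ⟨hIA, hIe⟩ := integrableOn_tubeStat_enskogRate_orbit H6 hgood k l (τ := τ) hσ hχ hg hg6 hL0 hr hκ.le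
    have heq := evenStat_sub_evenTubeTimeStat_eq (Φ := Φ N) z hIA hIe
    rw [hE, Set.mem_setOf_eq, heq] at hz
    exact hz
  have hgoodc : P (Φ N).goodᶜ = 0 := localGibbsLaw_goodCompl (Φ N)
  calc P E = P (E ∩ (Φ N).good ∪ E \ (Φ N).good) := by rw [Set.inter_union_sdiff]
    _ ≤ P (E ∩ (Φ N).good) + P (E \ (Φ N).good) := measure_union_le _ _
    _ ≤ P E' + 0 := by
        refine add_le_add (measure_mono hsub) ?_
        exact (measure_mono fun z hz => hz.2).trans hgoodc.le
    _ ≤ ENNReal.ofReal δ := by rw [add_zero]; exact E1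

end Summit.AtomisticToContinuum.HydrodynamicLimit.Theorems.EvenStressEnskog

end
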